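import Summits.AtomisticToContinuum.BoseEinsteinCondensation.Theorems.BECInsertionCorrectorCorrectorClosureResponseDictionarySin
import HarnessLib

/-!
# Line `insertion-mode-gaussian-domination`, stub S2 `stub_firstOrderInput` — K1 in `H₋₁` currency for
# both quadratures of the bath density mode (crux `BECInsertionCorrector.CorrectorClosure`,
# item stmt-AtomisticToContinuum-12058)

Supports (does not close) stmt-AtomisticToContinuum-12058, route `BECInsertionCorrector`. This is where the
line CONSUMES the crux hypothesis K1 = `StaticResponseBound` (by name). For every repulsive finite-range `v`,
K1 yields `ρ₀ > 0` and `C > 0`; with `B₁ := 2C`, `ρ₂ := ρ₀`, for `0 < ρ < ρ₀`, every `N ≥ 1` (hence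
eventually), the box `L = sideLength ρ (N+1)` with bounded periodisation `v^per`, every continuous torus
Feynman–Kac ground state `Θ₀` of the `N`-body bath and every mode `n ≠ 0` (`p = 2πn/L`):
`‖C_n‖²₋₁ + ‖S_n‖²₋₁ ≤ B₁ N / max(ρ'a, p²)`, `C_n = ∑ⱼ cos(p·xⱼ)`, `S_n = ∑ⱼ sin(p·xⱼ)`, `ρ' = N/L³`,
`a` the scattering length, the norms being Kipnis–Varadhan `H₋₁` norms `hMinusOneSqW L Θ₀ ·` for the
weight `Θ₀`.

Proof (glue over landed lemmas of the sibling line `healing-scale-kac-insertion`): K1 at the bath density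
`ρ' = ρN/(N+1) ∈ (0, ρ₀)` lives in the SAME box (`sideLength_bath : sideLength ρ' N = sideLength ρ (N+1)`,
`density_bath : ρ' = N/L³`), so it is verbatim the energy-currency response hypothesis
`E₀ − C_K t² ≤ E(Ψ) + t∫(∑ⱼcos(p·xⱼ))|Ψ|²` with `C_K = C N/max(ρ'a, p²)`; the quarter-wavelength translation
`staticResponse_sin_of_cos` gives the same hypothesis for the sine mode; and the form-domain-free dictionary
`hMinusOneSqW_le_of_fk_staticResponse` (energy currency → `H₋₁` currency for a continuous FK ground state,
via mollification and Kipnis–Landim's variational formula) bounds each quadrature by `ofReal C_K`; finally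
`ofReal C_K + ofReal C_K = ofReal (2 C N/max(ρ'a, p²))`. Positivity of `Θ₀` is not used.
References (shape only): C. Kipnis, S. R. S. Varadhan, Comm. Math. Phys. 104 (1986) 1, (1.14);
C. Kipnis, C. Landim, Scaling Limits of Interacting Particle Systems (1999), App. 1 §6 (6.1).
-/

noncomputable section

open MeasureTheory Filter
open scoped ENNReal NNReal BigOperators

namespace Summit.AtomisticToContinuum.BoseEinsteinCondensation.Theorems.CorrectorClosure.InsertionModeGaussianDomination

open Literature.MathematicalPhysics.QuantumManyBody.BoseGas
open Summit.AtomisticToContinuum.BoseEinsteinCondensation.Theses.BECInsertionCorrector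
open Summit.AtomisticToContinuum.BoseEinsteinCondensation.Theorems.CorrectorClosure.Negative
  (sideLength_succ_pos)
open Summit.AtomisticToContinuum.BoseEinsteinCondensation.Theorems.CorrectorClosure.HealingScaleKacInsertion.ResponseDictionary
  (hMinusOneSqW_le_of_fk_staticResponse staticResponse_sin_of_cos sideLength_bath density_bath)

/-! ### The density modes: continuity, boundedness, Bose symmetry -/

/-- The cosine density mode `X ↦ ∑ⱼ cos(p·xⱼ)` is continuous. [folklore] -/
theorem continuous_sum_cos_phase {N : ℕ} (L : ℝ) (n : Fin 3 → ℤ) :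
    Continuous fun X : Config N => ∑ j, Real.cos (2 * Real.pi / L * ∑ i, (n i : ℝ) * X j i) := by
  refine continuous_finsetSum _ fun j _ => Real.continuous_cos.comp (continuous_const.mul
    (continuous_finsetSum _ fun i _ => continuous_const.mul ?_))
  exact (PiLp.continuous_apply 2 _ i).comp (continuous_apply j)

/-- The sine density mode `X ↦ ∑ⱼ sin(p·xⱼ)` is continuous. [folklore] -/
theorem continuous_sum_sin_phase {N : ℕ} (L : ℝ) (n : Fin 3 → ℤ) :
    Continuous fun X : Config N => ∑ j, Real.sin (2 * Real.pi / L * ∑ i, (n i : ℝ) * X j i) := by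
  refine continuous_finsetSum _ fun j _ => Real.continuous_sin.comp (continuous_const.mul
    (continuous_finsetSum _ fun i _ => continuous_const.mul ?_))
  exact (PiLp.continuous_apply 2 _ i).comp (continuous_apply j)

/-- `|∑ⱼ cos(p·xⱼ)| ≤ N`. [folklore] -/
theorem abs_sum_cos_phase_le {N : ℕ} (L : ℝ) (n : Fin 3 → ℤ) (X : Config N) :
    |∑ j, Real.cos (2 * Real.pi / L * ∑ i, (n i : ℝ) * X j i)| ≤ N :=
  calc |∑ j, Real.cos (2 * Real.pi / L * ∑ i, (n i : ℝ) * X j i)|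
      ≤ ∑ j : Fin N, |Real.cos (2 * Real.pi / L * ∑ i, (n i : ℝ) * X j i)| :=
        Finset.abs_sum_le_sum_abs _ _
    _ ≤ ∑ _j : Fin N, (1 : ℝ) := Finset.sum_le_sum fun j _ => Real.abs_cos_le_one _
    _ = N := by simp

/-- `|∑ⱼ sin(p·xⱼ)| ≤ N`. [folklore] -/
theorem abs_sum_sin_phase_le {N : ℕ} (L : ℝ) (n : Fin 3 → ℤ) (X : Config N) :
    |∑ j, Real.sin (2 * Real.pi / L * ∑ i, (n i : ℝ) * X j i)| ≤ N :=
  calc |∑ j, Real.sin (2 * Real.pi / L * ∑ i, (n i : ℝ) * X j i)|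
      ≤ ∑ j : Fin N, |Real.sin (2 * Real.pi / L * ∑ i, (n i : ℝ) * X j i)| :=
        Finset.abs_sum_le_sum_abs _ _
    _ ≤ ∑ _j : Fin N, (1 : ℝ) := Finset.sum_le_sum fun j _ => Real.abs_sin_le_one _
    _ = N := by simp

/-- The cosine density mode is Bose symmetric. [folklore] -/
theorem sum_cos_phase_comp_perm {N : ℕ} (L : ℝ) (n : Fin 3 → ℤ) (σ : Equiv.Perm (Fin N))
    (X : Config N) :
    (∑ j, Real.cos (2 * Real.pi / L * ∑ i, (n i : ℝ) * (X ∘ σ) j i)) =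
      ∑ j, Real.cos (2 * Real.pi / L * ∑ i, (n i : ℝ) * X j i) :=
  Equiv.sum_comp σ (fun j => Real.cos (2 * Real.pi / L * ∑ i, (n i : ℝ) * X j i))

/-- The sine density mode is Bose symmetric. [folklore] -/
theorem sum_sin_phase_comp_perm {N : ℕ} (L : ℝ) (n : Fin 3 → ℤ) (σ : Equiv.Perm (Fin N))
    (X : Config N) :
    (∑ j, Real.sin (2 * Real.pi / L * ∑ i, (n i : ℝ) * (X ∘ σ) j i)) =
      ∑ j, Real.sin (2 * Real.pi / L * ∑ i, (n i : ℝ) * X j i) :=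
  Equiv.sum_comp σ (fun j => Real.sin (2 * Real.pi / L * ∑ i, (n i : ℝ) * X j i))

/-! ### The registered stub -/

/-- **S2 `stub_firstOrderInput` — K1 in `H₋₁` currency for both quadratures of the bath density mode, at the
bath density, for the true FK bath ground state (K1 consumed HERE, by name).** Given `StaticResponseBound`, for
every repulsive finite-range `v` there are `B₁, ρ₂ > 0` such that for `0 < ρ < ρ₂`, all large `N`, the box
`L = sideLength ρ (N+1)` (`v^per` bounded) and every continuous positive torus Feynman–Kac ground state `Θ₀` of
the `N`-body bath, and every `n ≠ 0`: `‖C_n‖²₋₁ + ‖S_n‖²₋₁ ≤ B₁ N / max(ρ'a, p²)`, `ρ' = N/L³`, `a` the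
scattering length. Proof: K1 at `(ρ', N)`, `ρ' = ρN/(N+1) ∈ (0, ρ₀)`, lives in the same box
(`sideLength_bath`, `density_bath`); the sine hypothesis by the quarter-wavelength translation
(`staticResponse_sin_of_cos`); each quadrature by the energy → `H₋₁` dictionary for FK ground states
(`hMinusOneSqW_le_of_fk_staticResponse`); `B₁ = 2C`, `ρ₂ = ρ₀`. [cite: KipnisLandim1999, App. 1 §6 (6.1)] -/
theorem stub_firstOrderInput (hK1 : StaticResponseBound) (v : ℝ → ℝ≥0∞) (hv : IsRepulsiveFiniteRange v) :
    ∃ B₁ : ℝ, 0 < B₁ ∧ ∃ ρ₂ : ℝ, 0 < ρ₂ ∧ ∀ ρ : ℝ, 0 < ρ → ρ < ρ₂ → ∀ᶠ N : ℕ in atTop,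
      ∀ (L : ℝ), L = sideLength ρ (N + 1) → (∃ C : ℝ≥0, ∀ x, periodizedPotential v L x ≤ C) →
      ∀ (Θ₀ : Config N → ℝ), IsPeriodicGroundStateFK v L Θ₀ → Continuous Θ₀ → (∀ X, 0 < Θ₀ X) →
      ∀ (n : Fin 3 → ℤ), n ≠ 0 →
        hMinusOneSqW L Θ₀ (fun X => ∑ j, Real.cos (2 * Real.pi / L * ∑ i, (n i : ℝ) * X j i)) +
          hMinusOneSqW L Θ₀ (fun X => ∑ j, Real.sin (2 * Real.pi / L * ∑ i, (n i : ℝ) * X j i)) ≤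
        ENNReal.ofReal (B₁ * N / max ((N : ℝ) / L ^ 3 * (scatteringLength v).toReal)
          ((2 * Real.pi / L) ^ 2 * ∑ i, (n i : ℝ) ^ 2)) := by
  obtain ⟨ρ₀, hρ₀, C, hC, hK⟩ := hK1 v hv
  refine ⟨2 * C, by positivity, ρ₀, hρ₀, fun ρ hρ hρ₀' => ?_⟩
  filter_upwards [eventually_ge_atTop 1] with N hN L hL_def hb Θ₀ hΘ hΘc _hΘp n hn
  subst hL_def
  obtain ⟨C', hC'⟩ := hb
  have hL : 0 < sideLength ρ (N + 1) := sideLength_succ_pos hρ N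
  -- (i) box bookkeeping: K1 for the bath at density `ρ' = ρN/(N+1)` in the same box
  have hρ' : 0 < ρ * N / (N + 1) := by
    have : (0 : ℝ) < N := by exact_mod_cast hN
    positivity
  have hρ'lt : ρ * N / (N + 1) < ρ₀ := by
    have h1 : ρ * N / (N + 1) < ρ := by
      rw [div_lt_iff₀ (by positivity)]; nlinarith
    exact h1.trans hρ₀'
  have hKL := hK (ρ * N / (N + 1)) hρ' hρ'lt N n hn
  rw [sideLength_bath hρ hN, density_bath hρ N] at hKL
  set CK : ℝ := C * N / max (N / sideLength ρ (N + 1) ^ 3 * (scatteringLength v).toReal)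
    ((2 * Real.pi / sideLength ρ (N + 1)) ^ 2 * ∑ i, (n i : ℝ) ^ 2) with hCK
  have hCK0 : 0 ≤ CK := by
    rw [hCK]
    refine div_nonneg (mul_nonneg hC.le (Nat.cast_nonneg N)) (le_trans ?_ (le_max_right _ _))
    exact mul_nonneg (sq_nonneg _) (Finset.sum_nonneg fun i _ => sq_nonneg _)
  have hKcos : ∀ (t : ℝ) (Ψ : PeriodicTrialState N (sideLength ρ (N + 1))),
      periodicEnergy v Ψ ≠ ⊤ →
      (periodicGroundStateEnergy v N (sideLength ρ (N + 1))).toReal - CK * t ^ 2 ≤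
        (periodicEnergy v Ψ).toReal + t * ∫ X in cellN N (sideLength ρ (N + 1)),
          (∑ j, Real.cos (2 * Real.pi / sideLength ρ (N + 1) * ∑ i, (n i : ℝ) * X j i)) *
            ‖Ψ.ψ X‖ ^ 2 := by
    intro t Ψ hΨ
    have h := hKL t Ψ hΨ
    have e : C * t ^ 2 * N / max (N / sideLength ρ (N + 1) ^ 3 * (scatteringLength v).toReal)
        ((2 * Real.pi / sideLength ρ (N + 1)) ^ 2 * ∑ i, (n i : ℝ) ^ 2) = CK * t ^ 2 := by
      rw [hCK]; ring
    rw [e] at h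
    exact h
  -- (ii) the quarter-wavelength translation: the same hypothesis for the sine mode
  have hKsin : ∀ (t : ℝ) (Ψ : PeriodicTrialState N (sideLength ρ (N + 1))),
      periodicEnergy v Ψ ≠ ⊤ →
      (periodicGroundStateEnergy v N (sideLength ρ (N + 1))).toReal - CK * t ^ 2 ≤
        (periodicEnergy v Ψ).toReal + t * ∫ X in cellN N (sideLength ρ (N + 1)),
          (∑ j, Real.sin (2 * Real.pi / sideLength ρ (N + 1) * ∑ i, (n i : ℝ) * X j i)) *
            ‖Ψ.ψ X‖ ^ 2 :=
    fun t Ψ hΨ => staticResponse_sin_of_cos hL hn hKcos t Ψ hΨ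
  -- (iii) energy currency → `H₋₁` currency, per quadrature
  have hcos : hMinusOneSqW (sideLength ρ (N + 1)) Θ₀
      (fun X => ∑ j, Real.cos (2 * Real.pi / sideLength ρ (N + 1) * ∑ i, (n i : ℝ) * X j i)) ≤
      ENNReal.ofReal CK :=
    hMinusOneSqW_le_of_fk_staticResponse hv.1 hL hC' hΘ hΘc (continuous_sum_cos_phase _ n)
      (abs_sum_cos_phase_le _ n) (sum_cos_phase_comp_perm _ n) hKcos
  have hsin : hMinusOneSqW (sideLength ρ (N + 1)) Θ₀
      (fun X => ∑ j, Real.sin (2 * Real.pi / sideLength ρ (N + 1) * ∑ i, (n i : ℝ) * X j i)) ≤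
      ENNReal.ofReal CK :=
    hMinusOneSqW_le_of_fk_staticResponse hv.1 hL hC' hΘ hΘc (continuous_sum_sin_phase _ n)
      (abs_sum_sin_phase_le _ n) (sum_sin_phase_comp_perm _ n) hKsin
  -- (iv) add the two quadratures
  calc hMinusOneSqW (sideLength ρ (N + 1)) Θ₀
          (fun X => ∑ j, Real.cos (2 * Real.pi / sideLength ρ (N + 1) * ∑ i, (n i : ℝ) * X j i)) +
        hMinusOneSqW (sideLength ρ (N + 1)) Θ₀
          (fun X => ∑ j, Real.sin (2 * Real.pi / sideLength ρ (N + 1) * ∑ i, (n i : ℝ) * X j i))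
      ≤ ENNReal.ofReal CK + ENNReal.ofReal CK := add_le_add hcos hsin
    _ = ENNReal.ofReal (CK + CK) := (ENNReal.ofReal_add hCK0 hCK0).symm
    _ = ENNReal.ofReal (2 * C * N /
          max ((N : ℝ) / sideLength ρ (N + 1) ^ 3 * (scatteringLength v).toReal)
            ((2 * Real.pi / sideLength ρ (N + 1)) ^ 2 * ∑ i, (n i : ℝ) ^ 2)) := by
        congr 1
        rw [hCK]
        ring

end Summit.AtomisticToContinuum.BoseEinsteinCondensation.Theorems.CorrectorClosure.InsertionModeGaussianDomination

end
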